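import Summits.AnomalousDissipation.AnomalousDissipation.Theorems.PumpSignGateTameSignedMirrorLimitTGRellich

/-!
# Route PumpSignGate — support `TameSignedMirrorLimitTG` (stmt-AnomalousDissipation-27674): tools II (§3–§5)

Part 2 of 3 of the lens-6 g57 kernel K3: weak sequential compactness in `L²(T³;ℝ³)` for a finite family, weak limits carry honest weak
partial derivatives, and a.e. sign clauses pass to weak limits. Declarations byte-identical to K3 except: three `simp only` calls cite
`PiLp.smul_apply, smul_eq_mul` in place of the inlined one-liner `coord_smul`, and `integral_apply_coord` (gate `dedup.landed` vs
`Literature.Analysis.FluidPDE.CP25.integral_apply_coord'` in `MikadoHeatBlocks.lean`) is a local `have` inside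
`hasWeakPartialDeriv_of_weakLimit` instead of a top-level copy (the Mikado module is not imported here on purpose: heavy Onsager cone);
namespace `…Theorems.PumpSignGateTame`.
[cite: OzanskiPooley2018, Thm. 6.37] [folklore]
-/

-- `Summit.<Summit>.<Problem>` is the tree's mandated summit-side namespace (CONVENTIONS §2); single-conjunct summit, duplicate deliberate.
set_option linter.dupNamespace false

noncomputable section

namespace Summit.AnomalousDissipation.AnomalousDissipation.Theorems

namespace PumpSignGateTame

open MeasureTheory Filter Topology
open scoped InnerProductSpace ENNReal
open Literature.Analysis.FunctionSpaces Literature.Analysis.FluidPDE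
open Literature.Analysis.FunctionSpaces.Torus Literature.Analysis.FluidPDE.Torus
open Summit.AnomalousDissipation.AnomalousDissipation.Theses.PumpSignGate

/-! ## §3 Weak sequential compactness in `L²(T³; ℝ³)` for a finite family -/

/-- **Weak compactness, finite family.**  Bounded sequences `V_n^j` (`j ∈ Fin 3`) in `L²(T³; ℝ³)` have a
common subsequence converging weakly: `⟪V_{κ n}^j, z⟫ → ⟪G^j, z⟫` for every `z`.
[cite: OzanskiPooley2018, proof of Thm. 6.37 Step 1 (6.93), (6.96)–(6.97)] -/
theorem exists_subseq_weakLimit_fin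
    (V : ℕ → Fin 3 → Lp (EuclideanSpace ℝ (Fin 3)) 2 (volume : Measure (UnitAddTorus (Fin 3)))) {R : ℝ}
    (hR : ∀ n j, ‖V n j‖ ≤ R) :
    ∃ (κ : ℕ → ℕ) (G : Fin 3 → Lp (EuclideanSpace ℝ (Fin 3)) 2 (volume : Measure (UnitAddTorus (Fin 3)))),
      StrictMono κ ∧ ∀ j (z : Lp (EuclideanSpace ℝ (Fin 3)) 2 (volume : Measure (UnitAddTorus (Fin 3)))),
        Tendsto (fun n => ⟪V (κ n) j, z⟫_ℝ) atTop (𝓝 ⟪G j, z⟫_ℝ) := by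
  haveI : Fact ((2 : ℝ≥0∞) ≠ ∞) := ⟨ENNReal.ofNat_ne_top⟩
  obtain ⟨D, hDc, hDd⟩ := TopologicalSpace.exists_countable_dense
    (Lp (EuclideanSpace ℝ (Fin 3)) 2 (volume : Measure (UnitAddTorus (Fin 3))))
  haveI : Countable D := hDc.to_subtype
  obtain ⟨κ, hκ, hlim⟩ := Literature.Analysis.FunctionSpaces.exists_strictMono_forall_tendsto_real
    (fun n (p : Fin 3 × D) => ⟪V n p.1, (p.2 : Lp (EuclideanSpace ℝ (Fin 3)) 2 (volume : Measure (UnitAddTorus (Fin 3))))⟫_ℝ)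
    (fun p => ⟨R * ‖(p.2 : Lp (EuclideanSpace ℝ (Fin 3)) 2 (volume : Measure (UnitAddTorus (Fin 3))))‖,
      fun n => (abs_real_inner_le_norm _ _).trans
        (mul_le_mul_of_nonneg_right (hR n p.1) (norm_nonneg _))⟩)
  have hD : ((⊤ : Submodule ℝ (Lp (EuclideanSpace ℝ (Fin 3)) 2 (volume : Measure (UnitAddTorus (Fin 3))))) :
      Set (Lp (EuclideanSpace ℝ (Fin 3)) 2 (volume : Measure (UnitAddTorus (Fin 3))))) ⊆
      closure (Submodule.span ℝ D : Set (Lp (EuclideanSpace ℝ (Fin 3)) 2 (volume : Measure (UnitAddTorus (Fin 3))))) :=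
    fun v _ => by
      rw [(hDd.mono Submodule.subset_span).closure_eq]; trivial
  have hG : ∀ j, ∃ G : Lp (EuclideanSpace ℝ (Fin 3)) 2 (volume : Measure (UnitAddTorus (Fin 3))),
      ∀ z, Tendsto (fun n => ⟪V (κ n) j, z⟫_ℝ) atTop (𝓝 ⟪G, z⟫_ℝ) := fun j => by
    obtain ⟨G, -, -, hG⟩ := Literature.Analysis.FunctionSpaces.exists_mem_tendsto_inner_of_subset_closure_span
      (⊤ : Submodule ℝ (Lp (EuclideanSpace ℝ (Fin 3)) 2 (volume : Measure (UnitAddTorus (Fin 3)))))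
      isClosed_univ hD (v := fun n => V (κ n) j) (fun _ => trivial) (fun n => hR (κ n) j)
      (fun d hd => hlim ⟨j, ⟨d, hd⟩⟩)
    exact ⟨G, hG⟩
  choose G hG using hG
  exact ⟨κ, G, hκ, hG⟩

/-! ## §4 Weak gradients pass to the limit -/

/-- **Weak derivatives pass to strong-`L²`/weak-`L²` limits.**  If `u_n → v` in `L²`, `g_n` is an honest
`L²` weak `j`-th partial derivative of `u_n`, and `[g_n] ⇀ G` weakly in `L²`, then `G` is a weak `j`-th
partial derivative of `v`. [cite: Evans2010, §5.2.1 and §D.4] -/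
theorem hasWeakPartialDeriv_of_weakLimit {j : Fin 3}
    {u : ℕ → Lp (EuclideanSpace ℝ (Fin 3)) 2 (volume : Measure (UnitAddTorus (Fin 3)))}
    {v : Lp (EuclideanSpace ℝ (Fin 3)) 2 (volume : Measure (UnitAddTorus (Fin 3)))}
    (hu : Tendsto u atTop (𝓝 v))
    {g : ℕ → UnitAddTorus (Fin 3) → EuclideanSpace ℝ (Fin 3)} (hg : ∀ n, MemLp (g n) 2 volume)
    (hwd : ∀ n, HasWeakPartialDeriv j ((u n : Lp (EuclideanSpace ℝ (Fin 3)) 2 (volume : Measure (UnitAddTorus (Fin 3)))) : UnitAddTorus (Fin 3) → EuclideanSpace ℝ (Fin 3)) (g n))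
    {G : Lp (EuclideanSpace ℝ (Fin 3)) 2 (volume : Measure (UnitAddTorus (Fin 3)))}
    (hG : ∀ z : Lp (EuclideanSpace ℝ (Fin 3)) 2 (volume : Measure (UnitAddTorus (Fin 3))),
      Tendsto (fun n => ⟪(hg n).toLp (g n), z⟫_ℝ) atTop (𝓝 ⟪G, z⟫_ℝ)) :
    HasWeakPartialDeriv j (v : UnitAddTorus (Fin 3) → EuclideanSpace ℝ (Fin 3))
      ((G : Lp (EuclideanSpace ℝ (Fin 3)) 2 (volume : Measure (UnitAddTorus (Fin 3)))) : UnitAddTorus (Fin 3) → EuclideanSpace ℝ (Fin 3)) := by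
  intro φ hφ
  -- coordinates of a Bochner integral in `ℝ³` (local form; the tree lemma
  -- `Literature.Analysis.FluidPDE.CP25.integral_apply_coord'` states the same — census g17 dedup note)
  have integral_apply_coord : ∀ {F : UnitAddTorus (Fin 3) → EuclideanSpace ℝ (Fin 3)}, Integrable F volume →
      ∀ i : Fin 3, (∫ x, F x) i = ∫ x, F x i := fun {F} hF i => by
    have h := (ContinuousLinearMap.integral_comp_comm (EuclideanSpace.proj i) hF).symm
    simpa using h
  have hφ' : IsSmooth (Torus.partialDeriv j φ) := hφ.partialDeriv j
  -- the two test fields `∂_jφ e_i`, `φ e_i`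
  have hz₁ : ∀ i : Fin 3, MemLp (fun x => Torus.partialDeriv j φ x • EuclideanSpace.single i (1 : ℝ)) 2
      (volume : Measure (UnitAddTorus (Fin 3))) := fun i => memLp_two_smul_single hφ'.continuous i
  have hz₂ : ∀ i : Fin 3, MemLp (fun x => φ x • EuclideanSpace.single i (1 : ℝ)) 2
      (volume : Measure (UnitAddTorus (Fin 3))) := fun i => memLp_two_smul_single hφ.continuous i
  -- integrability of the four integrands
  have hIv : Integrable (fun x => Torus.partialDeriv j φ x • (v : UnitAddTorus (Fin 3) → EuclideanSpace ℝ (Fin 3)) x) volume :=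
    hφ'.integrable_smul ((Lp.memLp v).integrable one_le_two)
  have hIG : Integrable (fun x => φ x • ((G : Lp (EuclideanSpace ℝ (Fin 3)) 2 (volume : Measure (UnitAddTorus (Fin 3)))) : UnitAddTorus (Fin 3) → EuclideanSpace ℝ (Fin 3)) x) volume :=
    hφ.integrable_smul ((Lp.memLp G).integrable one_le_two)
  have hIu : ∀ n, Integrable (fun x => Torus.partialDeriv j φ x • (u n : UnitAddTorus (Fin 3) → EuclideanSpace ℝ (Fin 3)) x) volume :=
    fun n => hφ'.integrable_smul ((Lp.memLp (u n)).integrable one_le_two)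
  have hIg : ∀ n, Integrable (fun x => φ x • g n x) volume :=
    fun n => hφ.integrable_smul ((hg n).integrable one_le_two)
  -- reduce to coordinates
  ext i
  rw [integral_apply_coord hIv i, PiLp.neg_apply, integral_apply_coord hIG i]
  -- the coordinate identities along the sequence
  have hn : ∀ n, ∫ x, (Torus.partialDeriv j φ x • (u n : UnitAddTorus (Fin 3) → EuclideanSpace ℝ (Fin 3)) x) i =
      -∫ x, (φ x • g n x) i := fun n => by
    rw [← integral_apply_coord (hIu n) i, ← integral_apply_coord (hIg n) i, hwd n φ hφ, PiLp.neg_apply]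
  -- left side: norm-continuous pairing with `∂_jφ e_i`
  have hL : Tendsto (fun n => ∫ x, (Torus.partialDeriv j φ x • (u n : UnitAddTorus (Fin 3) → EuclideanSpace ℝ (Fin 3)) x) i)
      atTop (𝓝 (∫ x, (Torus.partialDeriv j φ x • (v : UnitAddTorus (Fin 3) → EuclideanSpace ℝ (Fin 3)) x) i)) := by
    have h := Filter.Tendsto.inner (𝕜 := ℝ) hu (tendsto_const_nhds (x := (hz₁ i).toLp _))
    have e : ∀ w : Lp (EuclideanSpace ℝ (Fin 3)) 2 (volume : Measure (UnitAddTorus (Fin 3))),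
        ⟪w, (hz₁ i).toLp _⟫_ℝ = ∫ x, (Torus.partialDeriv j φ x • (w : UnitAddTorus (Fin 3) → EuclideanSpace ℝ (Fin 3)) x) i :=
      fun w => by
        rw [inner_toLp_eq_integral]
        exact integral_congr_ae (Eventually.of_forall fun x => by simp only [inner_smul_single_one, PiLp.smul_apply, smul_eq_mul])
    simpa only [e] using h
  -- right side: weakly continuous pairing with `φ e_i`
  have hRt : Tendsto (fun n => ∫ x, (φ x • g n x) i) atTop
      (𝓝 (∫ x, (φ x • ((G : Lp (EuclideanSpace ℝ (Fin 3)) 2 (volume : Measure (UnitAddTorus (Fin 3)))) : UnitAddTorus (Fin 3) → EuclideanSpace ℝ (Fin 3)) x) i)) := by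
    have h := hG ((hz₂ i).toLp _)
    have e1 : ∀ n, ⟪(hg n).toLp (g n), (hz₂ i).toLp _⟫_ℝ = ∫ x, (φ x • g n x) i := fun n => by
      rw [inner_toLp_toLp_eq_integral]
      exact integral_congr_ae (Eventually.of_forall fun x => by simp only [inner_smul_single_one, PiLp.smul_apply, smul_eq_mul])
    have e2 : ⟪G, (hz₂ i).toLp _⟫_ℝ =
        ∫ x, (φ x • ((G : Lp (EuclideanSpace ℝ (Fin 3)) 2 (volume : Measure (UnitAddTorus (Fin 3)))) : UnitAddTorus (Fin 3) → EuclideanSpace ℝ (Fin 3)) x) i := by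
      rw [inner_toLp_eq_integral]
      exact integral_congr_ae (Eventually.of_forall fun x => by simp only [inner_smul_single_one, PiLp.smul_apply, smul_eq_mul])
    rw [e2] at h
    exact h.congr fun n => e1 n
  have hE : (fun n => ∫ x, (Torus.partialDeriv j φ x • (u n : UnitAddTorus (Fin 3) → EuclideanSpace ℝ (Fin 3)) x) i) =
      fun n => -∫ x, (φ x • g n x) i := funext hn
  rw [hE] at hL
  exact tendsto_nhds_unique hL hRt.neg

/-! ## §5 A.e. sign conditions pass to weak limits -/

/-- The set integral of the signed density `((V)_a − (V')_b) s` over a measurable `B` as a difference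
of two `L²` pairings with the bounded test fields `1_B s e_a`, `1_B s e_b`. [folklore] -/
theorem setIntegral_signDensity_eq
    (V V' : Lp (EuclideanSpace ℝ (Fin 3)) 2 (volume : Measure (UnitAddTorus (Fin 3))))
    {B : Set (UnitAddTorus (Fin 3))} (hB : MeasurableSet B) {s : UnitAddTorus (Fin 3) → ℝ} (a b : Fin 3)
    (hzA : MemLp (fun x => B.indicator s x • EuclideanSpace.single a (1 : ℝ)) 2 (volume : Measure (UnitAddTorus (Fin 3))))
    (hzB : MemLp (fun x => B.indicator s x • EuclideanSpace.single b (1 : ℝ)) 2 (volume : Measure (UnitAddTorus (Fin 3)))) :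
    ∫ x in B, (((V : UnitAddTorus (Fin 3) → EuclideanSpace ℝ (Fin 3)) x) a -
        ((V' : UnitAddTorus (Fin 3) → EuclideanSpace ℝ (Fin 3)) x) b) * s x =
      ⟪V, hzA.toLp _⟫_ℝ - ⟪V', hzB.toLp _⟫_ℝ := by
  rw [inner_toLp_eq_integral, inner_toLp_eq_integral, ← integral_indicator hB]
  have hIA : Integrable (fun x => ⟪(V : UnitAddTorus (Fin 3) → EuclideanSpace ℝ (Fin 3)) x,
      B.indicator s x • EuclideanSpace.single a (1 : ℝ)⟫_ℝ) volume := by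
    have h := MeasureTheory.L2.integrable_inner (𝕜 := ℝ) V (hzA.toLp _)
    refine h.congr ?_
    filter_upwards [hzA.coeFn_toLp] with x hx
    rw [hx]
  have hIB : Integrable (fun x => ⟪(V' : UnitAddTorus (Fin 3) → EuclideanSpace ℝ (Fin 3)) x,
      B.indicator s x • EuclideanSpace.single b (1 : ℝ)⟫_ℝ) volume := by
    have h := MeasureTheory.L2.integrable_inner (𝕜 := ℝ) V' (hzB.toLp _)
    refine h.congr ?_
    filter_upwards [hzB.coeFn_toLp] with x hx
    rw [hx]
  rw [← integral_sub hIA hIB]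
  refine integral_congr_ae (Eventually.of_forall fun x => ?_)
  simp only [inner_smul_single_one]
  rw [Set.indicator_mul_right]
  ring

/-- **A.e. sign conditions on a measurable set pass to weak `L²` limits.**  If `⟪V_n, z⟫ → ⟪G, z⟫` and
`⟪V'_n, z⟫ → ⟪G', z⟫` for every `z`, and `((V_n)_a − (V'_n)_b) s ≥ 0` a.e. on `W` for every `n`
(`s` continuous), then `((G)_a − (G')_b) s ≥ 0` a.e. on `W`. [cite: Evans2010, §D.4] -/
theorem ae_sign_of_weakLimit {W : Set (UnitAddTorus (Fin 3))} (hW : MeasurableSet W)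
    {s : UnitAddTorus (Fin 3) → ℝ} (hs : Continuous s) (a b : Fin 3)
    {V V' : ℕ → Lp (EuclideanSpace ℝ (Fin 3)) 2 (volume : Measure (UnitAddTorus (Fin 3)))}
    {G G' : Lp (EuclideanSpace ℝ (Fin 3)) 2 (volume : Measure (UnitAddTorus (Fin 3)))}
    (hG : ∀ z, Tendsto (fun n => ⟪V n, z⟫_ℝ) atTop (𝓝 ⟪G, z⟫_ℝ))
    (hG' : ∀ z, Tendsto (fun n => ⟪V' n, z⟫_ℝ) atTop (𝓝 ⟪G', z⟫_ℝ))
    (hsign : ∀ n, ∀ᵐ x ∂(volume : Measure (UnitAddTorus (Fin 3))), x ∈ W →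
      0 ≤ (((V n : UnitAddTorus (Fin 3) → EuclideanSpace ℝ (Fin 3)) x) a -
        ((V' n : UnitAddTorus (Fin 3) → EuclideanSpace ℝ (Fin 3)) x) b) * s x) :
    ∀ᵐ x ∂(volume : Measure (UnitAddTorus (Fin 3))), x ∈ W →
      0 ≤ (((G : UnitAddTorus (Fin 3) → EuclideanSpace ℝ (Fin 3)) x) a -
        ((G' : UnitAddTorus (Fin 3) → EuclideanSpace ℝ (Fin 3)) x) b) * s x := by
  obtain ⟨C, hC⟩ := exists_forall_norm_le_of_continuous_torus hs
  -- the bounded test fields `1_B s e_c` are in `L²`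
  have hz : ∀ {B : Set (UnitAddTorus (Fin 3))}, MeasurableSet B → ∀ c : Fin 3,
      MemLp (fun x => B.indicator s x • EuclideanSpace.single c (1 : ℝ)) 2 (volume : Measure (UnitAddTorus (Fin 3))) := by
    intro B hB c
    refine memLp_two_of_bound ((hs.measurable.indicator hB).aestronglyMeasurable.smul_const _)
      (C * ‖EuclideanSpace.single c (1 : ℝ)‖) fun x => ?_
    rw [norm_smul]
    refine mul_le_mul_of_nonneg_right ?_ (norm_nonneg _)
    rw [Real.norm_eq_abs]
    by_cases hx : x ∈ B
    · rw [Set.indicator_of_mem hx]; exact (Real.norm_eq_abs _).symm.le.trans (hC x)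
    · rw [Set.indicator_of_notMem hx, abs_zero]; exact (norm_nonneg _).trans (hC x)
  -- the limit density is integrable
  set ℓ : UnitAddTorus (Fin 3) → ℝ := fun x =>
    (((G : UnitAddTorus (Fin 3) → EuclideanSpace ℝ (Fin 3)) x) a -
      ((G' : UnitAddTorus (Fin 3) → EuclideanSpace ℝ (Fin 3)) x) b) * s x with hℓ_def
  have hcoord : ∀ (F : Lp (EuclideanSpace ℝ (Fin 3)) 2 (volume : Measure (UnitAddTorus (Fin 3)))) (c : Fin 3),
      Integrable (fun x => (F : UnitAddTorus (Fin 3) → EuclideanSpace ℝ (Fin 3)) x c) volume := fun F c => by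
    have h := ContinuousLinearMap.integrable_comp (EuclideanSpace.proj (𝕜 := ℝ) (ι := Fin 3) c)
      ((Lp.memLp F).integrable one_le_two)
    simpa using h
  have hℓ : Integrable ℓ volume := by
    have h1 : Integrable (fun x => ((G : UnitAddTorus (Fin 3) → EuclideanSpace ℝ (Fin 3)) x) a -
        ((G' : UnitAddTorus (Fin 3) → EuclideanSpace ℝ (Fin 3)) x) b) volume := (hcoord G a).sub (hcoord G' b)
    have h2 := h1.bdd_mul hs.aestronglyMeasurable (Eventually.of_forall hC)
    refine h2.congr (Eventually.of_forall fun x => ?_)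
    simp only [hℓ_def]
    ring
  -- nonnegativity of all set integrals of `1_W ℓ`
  have key : 0 ≤ᵐ[volume] W.indicator ℓ := by
    refine ae_nonneg_of_forall_setIntegral_nonneg (hℓ.indicator hW) fun A hA _ => ?_
    rw [setIntegral_indicator hW]
    have hB : MeasurableSet (A ∩ W) := hA.inter hW
    rw [hℓ_def, setIntegral_signDensity_eq G G' hB a b (hz hB a) (hz hB b)]
    have hlim : Tendsto (fun n => ⟪V n, (hz hB a).toLp _⟫_ℝ - ⟪V' n, (hz hB b).toLp _⟫_ℝ) atTop
        (𝓝 (⟪G, (hz hB a).toLp _⟫_ℝ - ⟪G', (hz hB b).toLp _⟫_ℝ)) := (hG _).sub (hG' _)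
    refine ge_of_tendsto' hlim fun n => ?_
    rw [← setIntegral_signDensity_eq (V n) (V' n) hB a b (hz hB a) (hz hB b)]
    refine setIntegral_nonneg_ae hB ?_
    filter_upwards [hsign n] with x hx hxB
    exact hx hxB.2
  filter_upwards [key] with x hx hxW
  have h := hx
  simp only [Pi.zero_apply, Set.indicator_of_mem hxW] at h
  simpa [hℓ_def] using h

/-! ## §6 The route decl -/

/-- Transport of an a.e. sign condition along an a.e. equality of the two gradient fields. [folklore] -/
theorem ae_sign_congr {W : Set (UnitAddTorus (Fin 3))} {s : UnitAddTorus (Fin 3) → ℝ} {a b : Fin 3}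
    {gi gk Gi Gk : UnitAddTorus (Fin 3) → EuclideanSpace ℝ (Fin 3)}
    (hi : Gi =ᵐ[volume] gi) (hk : Gk =ᵐ[volume] gk)
    (h : ∀ᵐ x ∂(volume : Measure (UnitAddTorus (Fin 3))), x ∈ W → 0 ≤ ((gi x) a - (gk x) b) * s x) :
    ∀ᵐ x ∂(volume : Measure (UnitAddTorus (Fin 3))), x ∈ W → 0 ≤ ((Gi x) a - (Gk x) b) * s x := by
  filter_upwards [h, hi, hk] with x hx hxi hxk hxW
  rw [hxi, hxk]
  exact hx hxW

/-- Continuity of the torus coordinate distances `x ↦ min ‖x i‖ ‖x i − ½‖`. [folklore] -/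
theorem continuous_minDist (i : Fin 3) :
    Continuous fun x : UnitAddTorus (Fin 3) => min ‖x i‖ ‖x i - ((1 / 2 : ℝ) : UnitAddCircle)‖ :=
  (continuous_norm.comp (continuous_apply i)).min
    (continuous_norm.comp ((continuous_apply i).sub continuous_const))

/-- Continuity of `x ↦ Re e(x_i)` (`e = fourier 1` on the unit circle). [folklore] -/
theorem continuous_fourier_re (i : Fin 3) :
    Continuous fun x : UnitAddTorus (Fin 3) => ((fourier 1 (x i) : ℂ)).re :=
  Complex.continuous_re.comp ((map_continuous (fourier 1)).comp (continuous_apply i))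

/-- Continuity of `x ↦ Im e(x_i)`. [folklore] -/
theorem continuous_fourier_im (i : Fin 3) :
    Continuous fun x : UnitAddTorus (Fin 3) => ((fourier 1 (x i) : ℂ)).im :=
  Complex.continuous_im.comp ((map_continuous (fourier 1)).comp (continuous_apply i))

end PumpSignGateTame

end Summit.AnomalousDissipation.AnomalousDissipation.Theorems

end
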